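import Mathlib
import Literature.Computability.Complexity.SymmetricCircuit
import Summits.PneNP.PneNP.Theses.SymmetryBudget
import Summits.PneNP.PneNP.Theorems.SymmetryBudgetWindowBarrierHardToIdentifyBridge
import Summits.PneNP.PneNP.Theorems.SymmetryBudgetWindowBarrierTwinIsoQuasipoly
import Summits.PneNP.PneNP.Theorems.SymmetryBudgetWindowBarrierStubTwinIsoInP
import Literature.Computability.Complexity.GraphCanonization

/-!
# Capstone of line `bijection-gauge-twin-iso` for crux `SymmetryBudget.WindowBarrier` (item stmt-PneNP-2145)

`windowBarrier_of_twinIsoInP_of_twinIsoHard : TwinIsoInP → TwinIsoHard → WindowBarrier` and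
`windowBarrier_of_twinIsoInP_of_hardToIdentify : TwinIsoInP → HardToIdentify → WindowBarrier`, and their closed forms
`windowBarrier_of_twinIsoHard : babaiLuks1983_canonicalForm → TwinIsoHard → WindowBarrier`,
`windowBarrier_of_hardToIdentify : babaiLuks1983_canonicalForm → HardToIdentify → WindowBarrier`, kernel-checked:
the crux is the conjunction of "twin isomorphism ∈ P" (TwinIsoInP — the conclusion of the landed S_P
`stub_twinIsoInP_of_canonicalForm`, p89186, which derives it from the ONE literature debt, Babai–Luks 1983 canonical
forms `Literature.Computability.Complexity.babaiLuks1983_canonicalForm`; stated here as a hypothesis only because the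
farm has not yet built that module's olean) and the explicit-function lower bound TwinIsoHard (registered stub
`stub_twinIsoHard`), resp. its sufficient core HardToIdentify (bridge `twinIsoHard_of_hardToIdentify`, p86449): for every polynomial `p`, infinitely often no
`Bud(m,⌊log₂ m⌋)`-symmetric `tcBasis`-circuit of size `≤ p m` computes `x ↦ [Gr x [A] ≅ Gr x [B]]`, where `A`/`B` are
the free vertices adjacent / not adjacent to the ordered vertex `0`. Pieces: `twinIso_relabel_iff` (Bud-invariance of twin
isomorphism, every `m`), `windowBarrier_of_twinIso` (composition over `HasSymCircuit`/`pointStabiliserBudget`,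
definitionally the route decl's inline prelude). Both open parts are HYPOTHESES; no `sorry`, no new axiom.
-/

-- `Summit.PneNP.PneNP.…` duplicates `PneNP` BY DESIGN (single-problem summit, D-0017).
set_option linter.dupNamespace false

namespace Summit.PneNP.PneNP.Theorems

open Literature.Computability.Complexity Filter
open scoped Classical

namespace TwinIsoCapstone

/-! ## Composition over the landed Bud-invariance lemma `TwinIsoUB.twinIso_relabel_iff` (p90187) -/

open TwinIsoUB in
/-- **`TwinIsoInP → TwinIsoHard → WindowBarrier`**, the crux written over the landed vocabulary
(`HasSymCircuit tcBasis`, `pointStabiliserBudget`; definitionally the route's inline `HasSym`/`Bud`).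
Take `L` from `TwinIsoInP`: its slices are `Bud`-invariant for EVERY `m` by `twinIso_relabel_iff`, and
the slice function IS the twin-isomorphism function (pointwise `decide_eq_decide`), so `TwinIsoHard`
is the hardness clause verbatim. -/
theorem windowBarrier_of_twinIso
    (hP : ∃ L ∈ Classes.P, ∀ (m : ℕ) (G : SimpleGraph (Fin m)),
      encodingGraph.encode ⟨m, G⟩ ∈ L ↔
        Nonempty
          (SimpleGraph.induce {u : Fin m | m ≤ (u : ℕ) + Nat.log 2 m ∧ ∃ h : 0 < m, G.Adj ⟨0, h⟩ u}
              G ≃g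
            SimpleGraph.induce {u : Fin m | m ≤ (u : ℕ) + Nat.log 2 m ∧ ¬ ∃ h : 0 < m, G.Adj ⟨0, h⟩ u}
              G))
    (hH : ∀ p : Polynomial ℕ, ∃ᶠ m in atTop,
      ¬ HasSymCircuit tcBasis (pointStabiliserBudget m (Nat.log 2 m)) (p.eval m)
        (fun x : Fin m × Fin m → Bool => decide (Nonempty
          (SimpleGraph.induce {u : Fin m | m ≤ (u : ℕ) + Nat.log 2 m ∧ ∃ h : 0 < m, (SimpleGraph.fromRel fun u v => x (u, v) = true).Adj ⟨0, h⟩ u}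
              (SimpleGraph.fromRel fun u v => x (u, v) = true) ≃g
            SimpleGraph.induce {u : Fin m | m ≤ (u : ℕ) + Nat.log 2 m ∧ ¬ ∃ h : 0 < m, (SimpleGraph.fromRel fun u v => x (u, v) = true).Adj ⟨0, h⟩ u}
              (SimpleGraph.fromRel fun u v => x (u, v) = true))))) :
    ∃ L ∈ Classes.P,
      (∀ m : ℕ, ∀ ρ ∈ pointStabiliserBudget m (Nat.log 2 m), ∀ x : Fin m × Fin m → Bool,
        encodingGraph.encode ⟨m, SimpleGraph.fromRel fun u v => x (ρ u, ρ v) = true⟩ ∈ L ↔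
          encodingGraph.encode ⟨m, SimpleGraph.fromRel fun u v => x (u, v) = true⟩ ∈ L) ∧
      ∀ p : Polynomial ℕ, ∃ᶠ m in atTop,
        ¬ HasSymCircuit tcBasis (pointStabiliserBudget m (Nat.log 2 m)) (p.eval m)
            (fun x : Fin m × Fin m → Bool =>
              decide (encodingGraph.encode ⟨m, SimpleGraph.fromRel fun u v => x (u, v) = true⟩ ∈ L)) := by
  obtain ⟨L, hLP, hL⟩ := hP
  refine ⟨L, hLP, ?_, ?_⟩
  · intro m ρ hρ x
    exact (hL m _).trans ((twinIso_relabel_iff hρ x).trans (hL m _).symm)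
  · intro p
    refine (hH p).mono fun m hm => ?_
    have hfun : (fun x : Fin m × Fin m → Bool =>
        decide (encodingGraph.encode ⟨m, SimpleGraph.fromRel fun u v => x (u, v) = true⟩ ∈ L)) =
        (fun x : Fin m × Fin m → Bool => decide (
      Nonempty
      (SimpleGraph.induce {u : Fin m | m ≤ (u : ℕ) + Nat.log 2 m ∧ ∃ h : 0 < m, (SimpleGraph.fromRel fun u v => x (u, v) = true).Adj ⟨0, h⟩ u}
          (SimpleGraph.fromRel fun u v => x (u, v) = true) ≃g
        SimpleGraph.induce {u : Fin m | m ≤ (u : ℕ) + Nat.log 2 m ∧ ¬ ∃ h : 0 < m, (SimpleGraph.fromRel fun u v => x (u, v) = true).Adj ⟨0, h⟩ u}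
          (SimpleGraph.fromRel fun u v => x (u, v) = true)))) := by
      funext x
      exact decide_eq_decide.2 (hL m _)
    rw [hfun]
    exact hm


end TwinIsoCapstone

open TwinIsoCapstone

/-- **Capstone of line `bijection-gauge-twin-iso` (i): `WindowBarrier` from TwinIsoInP and TwinIsoHard.** The
language is twin isomorphism (hypothesis TwinIsoInP = conclusion of the landed `stub_twinIsoInP_of_canonicalForm`,
p89186, ⟸ Babai–Luks); its slices are `Bud`-invariant at every `m` (`twinIso_relabel_iff`) and the hardness clause
is TwinIsoHard verbatim (`windowBarrier_of_twinIso`); the route decl's inline `let Sym … HasSym … Bud … Gr …` prelude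
is definitionally `Circuit.IsSymmetricUnder` / `HasSymCircuit tcBasis` / `pointStabiliserBudget` / `SimpleGraph.fromRel`,
so the restated crux closes the named one by `exact`. -/
theorem windowBarrier_of_twinIsoInP_of_twinIsoHard :
    (∃ L ∈ Classes.P, ∀ (m : ℕ) (G : SimpleGraph (Fin m)),
      encodingGraph.encode ⟨m, G⟩ ∈ L ↔
        Nonempty
          (SimpleGraph.induce {u : Fin m | m ≤ (u : ℕ) + Nat.log 2 m ∧ ∃ h : 0 < m, G.Adj ⟨0, h⟩ u}
              G ≃g
            SimpleGraph.induce {u : Fin m | m ≤ (u : ℕ) + Nat.log 2 m ∧ ¬ ∃ h : 0 < m, G.Adj ⟨0, h⟩ u}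
              G)) →
    (∀ p : Polynomial ℕ, ∃ᶠ m in atTop,
      ¬ HasSymCircuit tcBasis (pointStabiliserBudget m (Nat.log 2 m)) (p.eval m)
        (fun x : Fin m × Fin m → Bool => decide (Nonempty
          (SimpleGraph.induce {u : Fin m | m ≤ (u : ℕ) + Nat.log 2 m ∧ ∃ h : 0 < m, (SimpleGraph.fromRel fun u v => x (u, v) = true).Adj ⟨0, h⟩ u}
              (SimpleGraph.fromRel fun u v => x (u, v) = true) ≃g
            SimpleGraph.induce {u : Fin m | m ≤ (u : ℕ) + Nat.log 2 m ∧ ¬ ∃ h : 0 < m, (SimpleGraph.fromRel fun u v => x (u, v) = true).Adj ⟨0, h⟩ u}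
              (SimpleGraph.fromRel fun u v => x (u, v) = true))))) →
    Summit.PneNP.PneNP.Theses.SymmetryBudget.WindowBarrier := by
  intro hP hH
  have H := windowBarrier_of_twinIso hP hH
  exact H

/-- **Capstone of line `bijection-gauge-twin-iso` (ii): `WindowBarrier` from TwinIsoInP and HardToIdentify**, the
line's reshaped open core: compose (i) with the landed bridge `twinIsoHard_of_hardToIdentify` (p86449). So in the
tree `WindowBarrier ⟸ {babaiLuks1983_canonicalForm (via p89186), HardToIdentify}`. -/
theorem windowBarrier_of_twinIsoInP_of_hardToIdentify :
    (∃ L ∈ Classes.P, ∀ (m : ℕ) (G : SimpleGraph (Fin m)),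
      encodingGraph.encode ⟨m, G⟩ ∈ L ↔
        Nonempty
          (SimpleGraph.induce {u : Fin m | m ≤ (u : ℕ) + Nat.log 2 m ∧ ∃ h : 0 < m, G.Adj ⟨0, h⟩ u}
              G ≃g
            SimpleGraph.induce {u : Fin m | m ≤ (u : ℕ) + Nat.log 2 m ∧ ¬ ∃ h : 0 < m, G.Adj ⟨0, h⟩ u}
              G)) →
    (∀ c : ℕ, ∃ᶠ h in atTop, ∃ H : SimpleGraph (Fin h),
      ¬ HasSymCircuit tcBasis Set.univ (2 ^ (c * h))
        (fun x : Fin h × Fin h → Bool =>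
          decide (Nonempty ((SimpleGraph.fromRel fun u v => x (u, v) = true) ≃g H)))) →
    Summit.PneNP.PneNP.Theses.SymmetryBudget.WindowBarrier := by
  intro hP hHTI
  exact windowBarrier_of_twinIsoInP_of_twinIsoHard hP (twinIsoHard_of_hardToIdentify hHTI)


/-- **Capstone of line `bijection-gauge-twin-iso` (iii): `WindowBarrier` from Babai–Luks canonical forms and
TwinIsoHard** — the line's thesis `WB ⟸ BL83 ∧ TwinIsoHard` as ONE tree theorem: (i) with TwinIsoInP discharged by
the landed S_P `stub_twinIsoInP_of_canonicalForm` (p89186) applied to the named fact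
`Literature.Computability.Complexity.babaiLuks1983_canonicalForm` (whose body is that stub's hypothesis, definitionally). -/
theorem windowBarrier_of_twinIsoHard :
    babaiLuks1983_canonicalForm →
    (∀ p : Polynomial ℕ, ∃ᶠ m in atTop,
      ¬ HasSymCircuit tcBasis (pointStabiliserBudget m (Nat.log 2 m)) (p.eval m)
        (fun x : Fin m × Fin m → Bool => decide (Nonempty
          (SimpleGraph.induce {u : Fin m | m ≤ (u : ℕ) + Nat.log 2 m ∧ ∃ h : 0 < m, (SimpleGraph.fromRel fun u v => x (u, v) = true).Adj ⟨0, h⟩ u}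
              (SimpleGraph.fromRel fun u v => x (u, v) = true) ≃g
            SimpleGraph.induce {u : Fin m | m ≤ (u : ℕ) + Nat.log 2 m ∧ ¬ ∃ h : 0 < m, (SimpleGraph.fromRel fun u v => x (u, v) = true).Adj ⟨0, h⟩ u}
              (SimpleGraph.fromRel fun u v => x (u, v) = true))))) →
    Summit.PneNP.PneNP.Theses.SymmetryBudget.WindowBarrier := by
  intro hBL hH
  exact windowBarrier_of_twinIsoInP_of_twinIsoHard (stub_twinIsoInP_of_canonicalForm hBL) hH

/-- **Capstone of line `bijection-gauge-twin-iso` (iv): `WindowBarrier` from Babai–Luks canonical forms and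
HardToIdentify** — the crux is EXACTLY {one literature debt, one open core}:
`babaiLuks1983_canonicalForm → HardToIdentify → WindowBarrier` ((iii) ∘ bridge p86449). -/
theorem windowBarrier_of_hardToIdentify :
    babaiLuks1983_canonicalForm →
    (∀ c : ℕ, ∃ᶠ h in atTop, ∃ H : SimpleGraph (Fin h),
      ¬ HasSymCircuit tcBasis Set.univ (2 ^ (c * h))
        (fun x : Fin h × Fin h → Bool =>
          decide (Nonempty ((SimpleGraph.fromRel fun u v => x (u, v) = true) ≃g H)))) →
    Summit.PneNP.PneNP.Theses.SymmetryBudget.WindowBarrier := by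
  intro hBL hHTI
  exact windowBarrier_of_twinIsoHard hBL (twinIsoHard_of_hardToIdentify hHTI)

end Summit.PneNP.PneNP.Theorems
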